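import Summits.ABC.ABC.Theorems.IsogenyGlueCongruenceFrameOverPetersson
import Literature.NumberTheory.EllipticCurves.PeterssonNormLowerBoundSqrtProofs
import Literature.NumberTheory.EllipticCurves.NewformPeterssonSizeSiegelProofs
import HarnessLib

/-!
# Route IsogenyGlueCongruence — `Assembly` (stmt-ABC-2049): the abc exponent as a function of the
# Petersson exponent, and the unconditional shadow `c ≪_ε rad(abc)^{3/2+ε}` on `16 ∣ abc`

Helper file for item `Assembly := SemistableDegreeConjecture → ABC` (stmt-ABC-2049). The Frey–Murty
reduction (Murty 1999 Thm. 1 (i); Pasten 2024 §3) run with a Petersson lower bound of DEFICIENCY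
`η ∈ [0, 1]`,

> `Re (f, f)_{Γ₀(N)} ≥ c(ε) N^{1 − η − ε}` for the newform `f` of every elliptic curve of conductor `N`,

turns the sharp semistable modular-degree conjecture `deg φ ≤ C(ε) N^{2+ε}` into
`c ≤ C'(ε) rad(abc)^{1 + η + ε}` for the abc triples with `16 ∣ abc` (the triples whose
Serre-normalised Frey curve is semistable, so that the degree conjecture applies to it):
`abcLe_sixteen_of_semistableDegreeBound_of_deficiency`. The two instances that matter:

* `η = 0` is the named fact `murty_petersson_newform_lower_bound` (Hoffstein–Lockhart 1994 with
  the Goldfeld–Hoffstein–Lieman appendix; UNDISCHARGED in the tree) and gives the exponent `1 + ε`,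
  i.e. `Assembly` (through the `(u⁸, v⁸ − u⁸, v⁸)` reduction, which converts `1 + ε` on normalised
  triples into `(1 + ε)/(1 − 7ε)` on all triples) — this is the tree's
  `abcLe_of_semistableDegreeBound`;
* `η = 1/2` is PROVED in the tree (Iwaniec's elementary half of *Spectral Methods* Thm. 8.3:
  `(f, f) ≫ N^{1/2−δ}`, `murty_petersson_newform_lower_bound_of_half_lt`), whence the
  UNCONDITIONAL theorem `abcLe_threeHalves_sixteen_of_semistableDegreeConjecture`:
  `SemistableDegreeConjecture ⟹ c ≤ C(ε) rad(abc)^{3/2 + ε}` for all abc triples with `16 ∣ abc`.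

So, in numbers: what separates item `Assembly` from an unconditional proof is exactly the
deficiency `η = 1/2 → 0` in the Petersson bound, i.e. `L(1, Sym² f) ≫_ε N^{−ε}` versus the
elementary `≫ N^{−1/2−ε}` — and only for SEMISTABLE curves: `assembly_of_petersson_semistable`
derives `Assembly` from the deficiency-`0` bound restricted to semistable curves in global minimal
form (the Goldfeld–Hoffstein–Lieman range; the CM members of the named fact, which need Siegel's
theorem, are never used). (No transfer of the exponent `3/2 + ε` to the triples with `16 ∤ abc`
is claimed: an auxiliary-triple device `c' ≍ c^k`, `rad' ≤ rad · c^m` maps an exponent `κ` to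
`κ/(k − mκ)`, lossless only at `κ = 1`.)

Finally `petersson_lower_bound_rpow_of_zeroFree` (level-generic power form of the tree's effective
zero-free bound `IsNewform0.petersson_lower_bound_log_of_zeroFree'`) and
`assembly_of_noExceptionalZero_semistable` record the sharpest closing condition known for the item:
a de la Vallée-Poussin zero-free interval `[1 − 1/(A log(N+2)), 1]` for the Rankin–Selberg trace
zeta function `Z_f` of the newforms of SEMISTABLE elliptic curves (Goldfeld–Hoffstein–Lieman's
theorem for non-CM `f`, appendix to Hoffstein–Lockhart 1994 — not in the tree) implies `Assembly`.

Proof of the deficiency theorem: verbatim the tree proof of `abcLe_sixteen_of_semistableDegreeBound`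
(`DegreeConjectureAbcSemistable.lean`), feeding its pointwise real-arithmetic lemmas
`covolume_ge_of_deg_le`, `pow_six_le_of_estimates`, `le_of_pow_six_le` with the level-dependent
constant `c₂ N^{−η}` in place of `c₂`.

## References

* M. R. Murty, *Bounds for congruence primes*, Proc. Sympos. Pure Math. 66.1 (1999), Thm. 1, §2.
  [MurtyCongruencePrimes1999]
* H. Pasten, *Shimura curves and the abc conjecture*, J. Number Theory 254 (2024) =
  arXiv:1705.09251, §3. [PastenShimura2024]
* H. Iwaniec, *Spectral Methods of Automorphic Forms*, GSM 53 (2002), Thm. 8.3. [Iwaniec2002]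
* J. H. Silverman, *Heights and elliptic curves*, in: Arithmetic Geometry (1986), Cor. 2.3.
  [Silverman1986]
* J. Hoffstein, P. Lockhart, *Coefficients of Maass forms and the Siegel zero* (appendix by
  D. Goldfeld, J. Hoffstein, D. Lieman), Ann. of Math. 140 (1994), 161–181. [HoffsteinLockhart1994]
-/

-- `Summit.<Summit>.<Problem>` is the mandated summit-side namespace (CONVENTIONS §2); for the
-- single-conjunct summit `ABC` the two coincide, so the duplicate `ABC.ABC` is deliberate.
set_option linter.dupNamespace false

namespace Summit.ABC.ABC.Theorems

open Literature.NumberTheory.EllipticCurves Literature.NumberTheory.EllipticCurves.ModularForms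
open Literature.NumberTheory Literature.NumberTheory.Automorphic
open IsDedekindDomain WeierstrassCurve NumberField CongruenceSubgroup UniqueFactorizationMonoid
open _root_.MeasureTheory

/-- The exponent bookkeeping with deficiency: for `0 < δ ≤ 1`, `3δ ≤ ε`, `η ≤ 1`,
`(1 + η + 2δ)(6 + δ) ≤ 6 (1 + (η + ε))` (indeed the left side is `≤ 6 + 6η + 16δ`). [folklore] -/
theorem exponent_le_of_deficiency {δ ε η : ℝ} (hδ : 0 < δ) (hδ1 : δ ≤ 1) (hδε : 3 * δ ≤ ε)
    (hη1 : η ≤ 1) :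
    (1 + η + 2 * δ) * (6 + δ) ≤ 6 * (1 + (η + ε)) := by
  nlinarith

/-- **Semistable degree conjecture + Petersson bound of deficiency `η` ⟹ abc with exponent
`1 + η + ε` on the triples with `16 ∣ abc`.** Assume: (P_η) for every `ε > 0` there is `c > 0` with
`c N_E^{1−η−ε} ≤ Re (f,f)_{Γ₀(N_E)}` for the newform `f` of every SEMISTABLE elliptic curve over `ℚ`
in global minimal form, `N_E` its conductor (`0 ≤ η ≤ 1`; only semistable curves are ever fed to
it — the Frey curves of normalised triples — so the CM/Siegel case of the full Petersson fact is
not needed); and the `c²`-weighted semistable degree bound: for every `ε > 0` there is `C` such that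
every semistable elliptic `W/ℚ` in global minimal form admits at level `N_E` a parametrisation
datum with `deg ≤ C c² N_E^{2+ε}`. Then for every `ε > 0` there is `C` with
`c ≤ C rad(abc)^{1+η+ε}` for all abc triples with `16 ∣ abc`. Silverman's covolume inequality is
supplied by the tree (`silverman1986_discriminant_c4_covolume_holds`). With `η = 0` and the full
Petersson fact this is the tree's `abcLe_sixteen_of_semistableDegreeBound` (Murty 1999, Thm. 1 (i)).
[cite: MurtyCongruencePrimes1999, Thm. 1 (i), proof (run with a weaker Petersson bound)] -/
theorem abcLe_sixteen_of_semistableDegreeBound_of_deficiency {η : ℝ} (hη0 : 0 ≤ η) (hη1 : η ≤ 1)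
    (hP : ∀ ε : ℝ, 0 < ε → ∃ c : ℝ, 0 < c ∧ ∀ (W : WeierstrassCurve ℚ) [W.IsElliptic]
      [W.IsGloballyMinimal] [NeZero (W.conductorNorm ℤ)], W.IsSemistable ℤ →
        ∀ f : CuspForm (Gamma0 (W.conductorNorm ℤ)) 2, IsNewformOf W f →
          c * ((W.conductorNorm ℤ : ℕ) : ℝ) ^ (1 - η - ε) ≤
            (peterssonProduct (Gamma0 (W.conductorNorm ℤ)) 2 f f).re)
    (hdeg : ∀ ε : ℝ, 0 < ε → ∃ C : ℝ, ∀ (W : WeierstrassCurve ℚ) [W.IsElliptic]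
      [W.IsGloballyMinimal] [NeZero (W.conductorNorm ℤ)], W.IsSemistable ℤ →
        ∃ D : ModularParametrizationData W (W.conductorNorm ℤ),
          (D.deg : ℝ) ≤ C * (D.c : ℝ) ^ 2 * ((W.conductorNorm ℤ : ℕ) : ℝ) ^ (2 + ε)) :
    ∀ ε : ℝ, 0 < ε → ∃ C : ℝ, ∀ a b c : ℕ, DiophantineGeometry.IsABCTriple a b c →
      16 ∣ a * b * c →
        (c : ℝ) ≤ C * ((DiophantineGeometry.rad a b c : ℕ) : ℝ) ^ (1 + η + ε) := by
  have hS := silverman1986_discriminant_c4_covolume_holds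
  intro ε hε
  set δ : ℝ := min 1 (ε / 3) with hδdef
  have hδ : 0 < δ := lt_min one_pos (by positivity)
  have hδ1 : δ ≤ 1 := min_le_left _ _
  have hδε : 3 * δ ≤ ε := by have := min_le_right 1 (ε / 3); linarith
  obtain ⟨C₀, hC₀⟩ := hdeg δ hδ
  obtain ⟨c₂, hc₂, hPc⟩ := hP δ hδ
  obtain ⟨A₀, hA₀⟩ := hS δ hδ
  have hA : (0 : ℝ) ≤ max A₀ 1 := zero_le_one.trans (le_max_right _ _)
  have hC₁ : (0 : ℝ) < max C₀ 1 := one_pos.trans_le (le_max_right _ _)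
  set κ : ℝ := 4 * Real.pi ^ 2 * c₂ / max C₀ 1 with hκdef
  have hκ : 0 < κ := div_pos (by positivity) hC₁
  set M : ℝ := 8 * max A₀ 1 * κ ^ (-(6 + δ)) * (2 ^ 10) ^ (η * (6 + δ)) *
    (2 ^ 10) ^ ((1 + 2 * δ) * (6 + δ)) with hMdef
  have hM : 0 ≤ M := by positivity
  refine ⟨M ^ (1 / 6 : ℝ), fun a b c h h16 ↦ ?_⟩
  have h' := h
  obtain ⟨ha, hb, habc, hcop⟩ := h'
  have hc0 : 0 < c := by omega
  have habc0 : a * b * c ≠ 0 := by positivity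
  set R : ℝ := ((DiophantineGeometry.rad a b c : ℕ) : ℝ) with hRdef
  have hRpos : 0 < DiophantineGeometry.rad a b c := by
    rw [DiophantineGeometry.rad_def]; exact Nat.pos_of_ne_zero radical_ne_zero
  have hR : (1 : ℝ) ≤ R := by rw [hRdef]; exact_mod_cast hRpos
  -- Serre's normalisation and the semistable global minimal equation (12.18)
  obtain ⟨A, B, hAB, hA4, hB, hprod, hquad⟩ := exists_arrangement h h16
  have h0 : A * B * (A + B) ≠ 0 := by
    rw [← Int.natAbs_ne_zero, hprod]; exact habc0
  have h4 : 4 ∣ B - A - 1 := by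
    have : B - A - 1 = B - (A + 1) := by ring
    rw [this]; exact dvd_sub (dvd_trans (by norm_num) hB) hA4
  have h16' : 16 ∣ A * B := dvd_mul_of_dvd_right hB _
  set W : WeierstrassCurve ℚ := (freyIntModel₂ A B).baseChange ℚ with hWdef
  haveI : W.IsElliptic := isElliptic_freyIntModel₂ h0 h4 h16'
  haveI : W.IsGloballyMinimal :=
    isGloballyMinimal_of_forall_isMinimalAt_int _ (isMinimalAt_freyIntModel₂ hAB hA4 hB)
  have hN0 : 0 < W.conductorNorm ℤ := conductorNorm_pos_holds W
  haveI : NeZero (W.conductorNorm ℤ) := ⟨hN0.ne'⟩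
  have hss : W.IsSemistable ℤ := fun v ↦ isSemistableAt_freyIntModel₂ hAB h0 hA4 hB v
  obtain ⟨D, hD⟩ := hC₀ W hss
  set Nn : ℕ := W.conductorNorm ℤ with hNn
  have hNpos : (0 : ℝ) < ((Nn : ℕ) : ℝ) := by exact_mod_cast hN0
  -- the covolume bound, with the level-dependent Petersson constant `c₂ N^{-η}`
  have hxy : 0 ≤ (D.c : ℝ) ^ 2 * (Nn : ℝ) ^ (2 + δ) := by positivity
  have hD' : (D.deg : ℝ) ≤ max C₀ 1 * (D.c : ℝ) ^ 2 * (Nn : ℝ) ^ (2 + δ) := by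
    calc (D.deg : ℝ) ≤ C₀ * (D.c : ℝ) ^ 2 * (Nn : ℝ) ^ (2 + δ) := hD
      _ = C₀ * ((D.c : ℝ) ^ 2 * (Nn : ℝ) ^ (2 + δ)) := by ring
      _ ≤ max C₀ 1 * ((D.c : ℝ) ^ 2 * (Nn : ℝ) ^ (2 + δ)) :=
          mul_le_mul_of_nonneg_right (le_max_left _ _) hxy
      _ = _ := by ring
  have hPD := hPc W hss D.f D.isNewformOf
  have hPD' : c₂ * (Nn : ℝ) ^ (-η) * (Nn : ℝ) ^ (1 - δ) ≤
      (peterssonProduct (Gamma0 Nn) 2 D.f D.f).re := by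
    have e : c₂ * (Nn : ℝ) ^ (-η) * (Nn : ℝ) ^ (1 - δ) = c₂ * (Nn : ℝ) ^ (1 - η - δ) := by
      rw [mul_assoc, ← Real.rpow_add hNpos]; congr 1; ring_nf
    rw [e]; exact hPD
  have hlow := covolume_ge_of_deg_le D hC₁ hD' hPD'
  have hκ' : 0 < κ * (Nn : ℝ) ^ (-η) := mul_pos hκ (Real.rpow_pos_of_pos hNpos _)
  have hlow' : κ * (Nn : ℝ) ^ (-η) * (Nn : ℝ) ^ (-(1 + 2 * δ)) ≤ ZLattice.covolume D.L.lattice := by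
    have e : κ * (Nn : ℝ) ^ (-η) = 4 * Real.pi ^ 2 * (c₂ * (Nn : ℝ) ^ (-η)) / max C₀ 1 := by
      rw [hκdef]; ring
    rw [e]; exact hlow
  -- Silverman for the Néron lattice `D.L` of the minimal model `W`
  have hSW := hA₀ W D.L D.isNeronLattice
  have hcov : 0 < ZLattice.covolume D.L.lattice := ZLattice.covolume_pos _ _
  have hc₄W : W.c₄ = ((freyIntModel₂ A B).c₄ : ℚ) := by
    simp [hWdef, WeierstrassCurve.baseChange, WeierstrassCurve.map_c₄]
  have hc₄ : |((freyIntModel₂ A B).c₄ : ℝ)| ^ 3 ≤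
      max A₀ 1 * ZLattice.covolume D.L.lattice ^ (-(6 + δ)) := by
    have h1 : ((|W.c₄| ^ 3 : ℚ) : ℝ) ≤ ((max |W.Δ| (|W.c₄| ^ 3) : ℚ) : ℝ) := by
      exact_mod_cast le_max_right _ _
    have e1 : |((freyIntModel₂ A B).c₄ : ℝ)| ^ 3 = ((|W.c₄| ^ 3 : ℚ) : ℝ) := by
      rw [hc₄W]; norm_cast
    rw [e1]
    exact (h1.trans hSW).trans (mul_le_mul_of_nonneg_right (le_max_left A₀ 1)
      (Real.rpow_nonneg hcov.le _))
  -- `N ∣ rad(abc)` and `c² ≤ 2 c₄'`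
  have hdvd : Nn ∣ DiophantineGeometry.rad a b c := by
    rw [hNn, hWdef, DiophantineGeometry.rad_def, ← hprod]
    exact conductorNorm_freyIntModel₂_dvd hAB h0 hA4 hB
  have hNle : ((Nn : ℕ) : ℝ) ≤ 2 ^ 10 * R := by
    have h1 : ((Nn : ℕ) : ℝ) ≤ R := by rw [hRdef]; exact_mod_cast Nat.le_of_dvd hRpos hdvd
    exact h1.trans (le_mul_of_one_le_left (zero_le_one.trans hR) (by norm_num))
  have hcc4 : (c : ℝ) ^ 2 ≤ 2 * |((freyIntModel₂ A B).c₄ : ℝ)| := by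
    rw [freyIntModel₂_c₄ h4 h16']
    have hq : (0 : ℤ) ≤ A ^ 2 + A * B + B ^ 2 := by
      nlinarith [sq_nonneg (A + B), sq_nonneg A, sq_nonneg B]
    have hz : ((c : ℕ) : ℤ) ^ 2 ≤ 2 * |A ^ 2 + A * B + B ^ 2| := by
      rw [abs_of_nonneg hq, hquad]; nlinarith [sq_nonneg (a : ℤ), sq_nonneg (b : ℤ)]
    have hzr : (((c : ℕ) : ℤ) : ℝ) ^ 2 ≤ 2 * |((A ^ 2 + A * B + B ^ 2 : ℤ) : ℝ)| := by
      exact_mod_cast hz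
    simpa using hzr
  -- bookkeeping (`covol' = covol`), with the level-dependent constant
  have h6 := pow_six_le_of_estimates hδ hA hκ' hNpos hcov hcc4 hc₄ le_rfl hlow' hNle hR
  -- `(κ N^{-η})^{-(6+δ)} = κ^{-(6+δ)} N^{η(6+δ)} ≤ κ^{-(6+δ)} (2¹⁰)^{η(6+δ)} R^{η(6+δ)}`
  have hηe : 0 ≤ η * (6 + δ) := by positivity
  have hsplit : (κ * (Nn : ℝ) ^ (-η)) ^ (-(6 + δ)) = κ ^ (-(6 + δ)) * (Nn : ℝ) ^ (η * (6 + δ)) := by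
    rw [Real.mul_rpow hκ.le (Real.rpow_nonneg hNpos.le _), ← Real.rpow_mul hNpos.le]
    ring_nf
  have hNpow : (Nn : ℝ) ^ (η * (6 + δ)) ≤ (2 ^ 10) ^ (η * (6 + δ)) * R ^ (η * (6 + δ)) := by
    rw [← Real.mul_rpow (by positivity) (zero_le_one.trans hR)]
    exact Real.rpow_le_rpow hNpos.le hNle hηe
  have hκe : 0 ≤ κ ^ (-(6 + δ)) := Real.rpow_nonneg hκ.le _
  have hRe : 0 ≤ R ^ ((1 + 2 * δ) * (6 + δ)) := Real.rpow_nonneg (zero_le_one.trans hR) _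
  have h6' : (c : ℝ) ^ 6 ≤ M * R ^ ((1 + η + 2 * δ) * (6 + δ)) := by
    have hexp : R ^ ((1 + η + 2 * δ) * (6 + δ)) = R ^ (η * (6 + δ)) * R ^ ((1 + 2 * δ) * (6 + δ)) := by
      rw [← Real.rpow_add (zero_lt_one.trans_le hR)]; congr 1; ring
    calc (c : ℝ) ^ 6 ≤ 8 * max A₀ 1 * (κ * (Nn : ℝ) ^ (-η)) ^ (-(6 + δ)) *
          (2 ^ 10) ^ ((1 + 2 * δ) * (6 + δ)) * R ^ ((1 + 2 * δ) * (6 + δ)) := h6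
      _ = 8 * max A₀ 1 * (κ ^ (-(6 + δ)) * (Nn : ℝ) ^ (η * (6 + δ))) *
          (2 ^ 10) ^ ((1 + 2 * δ) * (6 + δ)) * R ^ ((1 + 2 * δ) * (6 + δ)) := by rw [hsplit]
      _ ≤ 8 * max A₀ 1 * (κ ^ (-(6 + δ)) * ((2 ^ 10) ^ (η * (6 + δ)) * R ^ (η * (6 + δ)))) *
          (2 ^ 10) ^ ((1 + 2 * δ) * (6 + δ)) * R ^ ((1 + 2 * δ) * (6 + δ)) := by
          gcongr
      _ = M * R ^ ((1 + η + 2 * δ) * (6 + δ)) := by rw [hexp, hMdef]; ring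
  have hfin := le_of_pow_six_le (Nat.cast_nonneg c) hM hR
    (exponent_le_of_deficiency hδ hδ1 hδε hη1) h6'
  simpa only [add_assoc] using hfin

/-- **Unconditional shadow of `Assembly`: the sharp semistable modular-degree conjecture implies
`c ≤ C(ε) rad(abc)^{3/2 + ε}` on the abc triples with `16 ∣ abc`.** The Petersson bound of
deficiency `η = 1/2` is Iwaniec's elementary `(f, f) ≫ N^{1/2−δ}`
(`murty_petersson_newform_lower_bound_of_half_lt`, proved in the tree), Silverman's inequality is
proved in the tree, and the Manin-constant padding
`semistableDegreeBound_cSq_of_semistableDegreeConjecture` supplies the `c²`-weighted degree bound.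
The missing `1/2` in the exponent is exactly the undischarged named fact
`murty_petersson_newform_lower_bound` (deficiency `0`, Hoffstein–Lockhart 1994).
[cite: Iwaniec2002, Thm. 8.3 (elementary half), with MurtyCongruencePrimes1999 Thm. 1 (i)] -/
theorem abcLe_threeHalves_sixteen_of_semistableDegreeConjecture
    (hX : Summit.ABC.ABC.Theses.IsogenyGlueCongruence.SemistableDegreeConjecture) :
    ∀ ε : ℝ, 0 < ε → ∃ C : ℝ, ∀ a b c : ℕ, DiophantineGeometry.IsABCTriple a b c →
      16 ∣ a * b * c →
        (c : ℝ) ≤ C * ((DiophantineGeometry.rad a b c : ℕ) : ℝ) ^ (3 / 2 + ε) := by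
  have hP : ∀ ε : ℝ, 0 < ε → ∃ c : ℝ, 0 < c ∧ ∀ (W : WeierstrassCurve ℚ) [W.IsElliptic]
      [W.IsGloballyMinimal] [NeZero (W.conductorNorm ℤ)], W.IsSemistable ℤ →
        ∀ f : CuspForm (Gamma0 (W.conductorNorm ℤ)) 2, IsNewformOf W f →
          c * ((W.conductorNorm ℤ : ℕ) : ℝ) ^ (1 - 1 / 2 - ε) ≤
            (peterssonProduct (Gamma0 (W.conductorNorm ℤ)) 2 f f).re := by
    intro ε hε
    obtain ⟨c, hc, h⟩ := murty_petersson_newform_lower_bound_of_half_lt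
      (show (1 : ℝ) / 2 < 1 / 2 + ε by linarith)
    refine ⟨c, hc, fun W _ _ _ _ f hf ↦ ?_⟩
    have e : (1 : ℝ) - 1 / 2 - ε = 1 - (1 / 2 + ε) := by ring
    rw [e]; exact h _ W f hf
  intro ε hε
  obtain ⟨C, hC⟩ := abcLe_sixteen_of_semistableDegreeBound_of_deficiency (η := 1 / 2)
    (by norm_num) (by norm_num) hP (semistableDegreeBound_cSq_of_semistableDegreeConjecture hX) ε hε
  refine ⟨C, fun a b c h h16 ↦ ?_⟩
  have e : (3 : ℝ) / 2 + ε = 1 + 1 / 2 + ε := by ring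
  rw [e]; exact hC a b c h h16

/-- **`Assembly` from the Petersson bound for SEMISTABLE curves only.** If for every `ε > 0` there
is `c > 0` with `Re (f,f)_{Γ₀(N_E)} ≥ c N_E^{1−ε}` for the newform `f` of every semistable elliptic
curve over `ℚ` in global minimal form (the non-CM range of the named fact
`murty_petersson_newform_lower_bound`: Goldfeld–Hoffstein–Lieman's "no Siegel zero for `Sym² f`",
effective, no Siegel theorem needed), then `SemistableDegreeConjecture → ABC`. Proof: deficiency
`η = 0` in `abcLe_sixteen_of_semistableDegreeBound_of_deficiency`, the `(u⁸, v⁸ − u⁸, v⁸)` reduction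
`abcLe_of_abcLe_sixteen_dvd`, and `abcLt_of_abcLe` (`ABC` unfolds to the `<`/`0 < C` sentence).
Strictly weaker hypothesis than `assembly_of_petersson` (sibling file `IsogenyGlueCongruenceAssembly`).
[cite: MurtyCongruencePrimes1999, Thm. 1 (i)] -/
theorem assembly_of_petersson_semistable
    (hP : ∀ ε : ℝ, 0 < ε → ∃ c : ℝ, 0 < c ∧ ∀ (W : WeierstrassCurve ℚ) [W.IsElliptic]
      [W.IsGloballyMinimal] [NeZero (W.conductorNorm ℤ)], W.IsSemistable ℤ →
        ∀ f : CuspForm (Gamma0 (W.conductorNorm ℤ)) 2, IsNewformOf W f →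
          c * ((W.conductorNorm ℤ : ℕ) : ℝ) ^ (1 - ε) ≤
            (peterssonProduct (Gamma0 (W.conductorNorm ℤ)) 2 f f).re) :
    Summit.ABC.ABC.Theses.IsogenyGlueCongruence.Assembly := by
  unfold Summit.ABC.ABC.Theses.IsogenyGlueCongruence.Assembly
  intro hX
  have hP0 : ∀ ε : ℝ, 0 < ε → ∃ c : ℝ, 0 < c ∧ ∀ (W : WeierstrassCurve ℚ) [W.IsElliptic]
      [W.IsGloballyMinimal] [NeZero (W.conductorNorm ℤ)], W.IsSemistable ℤ →
        ∀ f : CuspForm (Gamma0 (W.conductorNorm ℤ)) 2, IsNewformOf W f →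
          c * ((W.conductorNorm ℤ : ℕ) : ℝ) ^ (1 - 0 - ε) ≤
            (peterssonProduct (Gamma0 (W.conductorNorm ℤ)) 2 f f).re := by
    simpa only [sub_zero] using hP
  have h16 := abcLe_sixteen_of_semistableDegreeBound_of_deficiency (η := 0) le_rfl zero_le_one hP0
    (semistableDegreeBound_cSq_of_semistableDegreeConjecture hX)
  have h16' : ∀ ε : ℝ, 0 < ε → ∃ C : ℝ, ∀ a b c : ℕ, DiophantineGeometry.IsABCTriple a b c →
      16 ∣ a * b * c → (c : ℝ) ≤ C * ((DiophantineGeometry.rad a b c : ℕ) : ℝ) ^ (1 + ε) := by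
    simpa only [add_zero] using h16
  exact abcLt_of_abcLe (DiophantineGeometry.abcLe_of_abcLe_sixteen_dvd h16')

/-- **Power form of the tree's effective zero-free bound, per level.** For `A > 0` and `ε > 0`
there is `c > 0` such that for every `N ≥ 1` and every newform `f ∈ S₂(Γ₀(N))` (`IsNewform0 f`)
whose completed Rankin–Selberg trace zeta function
`Z_f(σ) = σ(σ−1) ∫_𝒟 G_f E₀*(·,σ) dμ + ½ ∫_𝒟 G_f dμ` has no zero on `[1 − 1/(A log(N+2)), 1]`,
`c N^{1−ε} ≤ Re (f,f)_{Γ₀(N)}`: the tree's `IsNewform0.petersson_lower_bound_log_of_zeroFree'`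
(`Re (f,f) ≥ c' N/log(N+2)` for every `A' ≥ A₀`, applied with `A' = max A A₀`, a narrower interval)
and `log(N+2) ≤ (3N)^ε/ε` (`Real.log_le_rpow_div`). Verbatim the level-generic core of the tree's
`murty_petersson_newform_lower_bound_of_noExceptionalZero`, with the elliptic curve removed.
[cite: HoffsteinLockhart1994, p. 161 and Thm. 0.1 (case of no exceptional zero)] -/
theorem petersson_lower_bound_rpow_of_zeroFree {A : ℝ} (hA : 0 < A) {ε : ℝ} (hε : 0 < ε) :
    ∃ c : ℝ, 0 < c ∧ ∀ (N : ℕ) [NeZero N] (f : CuspForm (Gamma0 N) 2), IsNewform0 f →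
      (∀ σ : ℝ, 1 - 1 / (A * Real.log (N + 2)) ≤ σ → σ ≤ 1 →
        (σ : ℂ) * (σ - 1) *
            (∫ w in ModularGroup.fd, (rsTrace N 2 f w : ℂ) * completedEisenstein₀ w σ) +
          (((∫ w in ModularGroup.fd, rsTrace N 2 f w : ℝ)) : ℂ) / 2 ≠ 0) →
      c * (N : ℝ) ^ (1 - ε) ≤ (peterssonProduct (Gamma0 N) 2 f f).re := by
  obtain ⟨A₀, _, h1⟩ := IsNewform0.petersson_lower_bound_log_of_zeroFree'
  obtain ⟨c, hc, hcN⟩ := h1 (max A A₀) (le_max_right _ _)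
  have h3ε : (0 : ℝ) < (3 : ℝ) ^ ε := Real.rpow_pos_of_pos (by norm_num) _
  refine ⟨c * ε / (3 : ℝ) ^ ε, by positivity, fun N _ f hf hZ ↦ ?_⟩
  have hN0 : (0 : ℝ) < N := Nat.cast_pos.mpr (NeZero.pos N)
  have hN1 : (1 : ℝ) ≤ N := by exact_mod_cast NeZero.one_le
  have hlogN0 : 0 < Real.log (N + 2) := Real.log_pos (by linarith)
  -- the zero-free hypothesis on the (narrower) interval for `max A A₀`
  have hZ' : ∀ σ : ℝ, 1 - 1 / (max A A₀ * Real.log (N + 2)) ≤ σ → σ ≤ 1 →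
      (σ : ℂ) * (σ - 1) * (∫ w in ModularGroup.fd, (rsTrace N 2 f w : ℂ) * completedEisenstein₀ w σ) +
        (((∫ w in ModularGroup.fd, rsTrace N 2 f w : ℝ)) : ℂ) / 2 ≠ 0 := by
    intro σ h1σ h2σ
    refine hZ σ (le_trans ?_ h1σ) h2σ
    have : 1 / (max A A₀ * Real.log (N + 2)) ≤ 1 / (A * Real.log (N + 2)) := by
      apply one_div_le_one_div_of_le (by positivity)
      exact mul_le_mul_of_nonneg_right (le_max_left _ _) hlogN0.le
    linarith
  have hmain := hcN N f hf hZ'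
  -- `log(N+2) ≤ (3N)^ε/ε`
  have hlog : Real.log (N + 2) ≤ (3 : ℝ) ^ ε * (N : ℝ) ^ ε / ε := by
    have h1 : Real.log ((N : ℝ) + 2) ≤ ((N : ℝ) + 2) ^ ε / ε :=
      Real.log_le_rpow_div (by positivity) hε
    have h2 : ((N : ℝ) + 2) ^ ε ≤ (3 * (N : ℝ)) ^ ε :=
      Real.rpow_le_rpow (by linarith) (by linarith) hε.le
    rw [Real.mul_rpow (by norm_num) hN0.le] at h2
    calc Real.log ((N : ℝ) + 2) ≤ ((N : ℝ) + 2) ^ ε / ε := h1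
      _ ≤ (3 : ℝ) ^ ε * (N : ℝ) ^ ε / ε := by gcongr
  calc c * ε / (3 : ℝ) ^ ε * (N : ℝ) ^ (1 - ε)
      = c * N / ((3 : ℝ) ^ ε * (N : ℝ) ^ ε / ε) := by
        rw [Real.rpow_sub hN0, Real.rpow_one]
        field_simp
    _ ≤ c * N / Real.log (N + 2) := by
        apply div_le_div_of_nonneg_left (by positivity) hlogN0 hlog
    _ ≤ (peterssonProduct (Gamma0 N) 2 f f).re := hmain

/-- **`Assembly` from "no exceptional zero" along the newforms of SEMISTABLE curves.** If for some
`A > 0` the completed Rankin–Selberg trace zeta function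
`Z_f(σ) = σ(σ−1) ∫_𝒟 G_f E₀*(·,σ) dμ + ½ ∫_𝒟 G_f dμ` of the newform `f` of every semistable elliptic
curve over `ℚ` in global minimal form (conductor `N`) does not vanish for
`1 − 1/(A log(N+2)) ≤ σ ≤ 1` — exactly what Goldfeld–Hoffstein–Lieman prove for `L(s, Sym² f)`,
`f` non-CM (appendix to Hoffstein–Lockhart 1994; semistable curves over `ℚ` are non-CM) — then
`SemistableDegreeConjecture → ABC`: `petersson_lower_bound_rpow_of_zeroFree` gives the
deficiency-`0` Petersson bound for semistable curves, then `assembly_of_petersson_semistable`.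
This is the weakest analytic hypothesis under which the item is known to close.
[cite: HoffsteinLockhart1994, Thm. 0.1 and Appendix (Goldfeld–Hoffstein–Lieman)] -/
theorem assembly_of_noExceptionalZero_semistable
    (h : ∃ A : ℝ, 0 < A ∧ ∀ (W : WeierstrassCurve ℚ) [W.IsElliptic] [W.IsGloballyMinimal]
      [NeZero (W.conductorNorm ℤ)], W.IsSemistable ℤ →
        ∀ f : CuspForm (Gamma0 (W.conductorNorm ℤ)) 2, IsNewformOf W f →
          ∀ σ : ℝ, 1 - 1 / (A * Real.log ((W.conductorNorm ℤ : ℕ) + 2)) ≤ σ → σ ≤ 1 →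
            (σ : ℂ) * (σ - 1) *
                (∫ w in ModularGroup.fd, (rsTrace (W.conductorNorm ℤ) 2 f w : ℂ) *
                  completedEisenstein₀ w σ) +
              (((∫ w in ModularGroup.fd, rsTrace (W.conductorNorm ℤ) 2 f w : ℝ)) : ℂ) / 2 ≠ 0) :
    Summit.ABC.ABC.Theses.IsogenyGlueCongruence.Assembly := by
  obtain ⟨A, hA, hZ⟩ := h
  refine assembly_of_petersson_semistable fun ε hε ↦ ?_
  obtain ⟨c, hc, hcN⟩ := petersson_lower_bound_rpow_of_zeroFree hA hε
  exact ⟨c, hc, fun W _ _ _ hss f hf ↦ hcN _ f hf.1 (hZ W hss f hf)⟩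

end Summit.ABC.ABC.Theorems
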